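import Summits.NavierStokesRegularity.NavierStokesRegularity.Theorems.TypeIIInviscidRelaxationAxisymSwirlRegularCoreStrainCriterion
import Summits.NavierStokesRegularity.NavierStokesRegularity.Theorems.TypeIIInviscidRelaxationAxisymSwirlRegularSimilarityTools
import HarnessLib

/-!
# The two-level / core-strain criteria near the blow-up time and on a thin tube

Helper toward the crux `AxisymSwirlRegular` (stmt-NavierStokesRegularity-1964, route TypeIIInviscidRelaxation),
criterion side of the registered line `radial_inflow_split` (stub `stub_oneSidedRadialCriterion`, ⟨19059⟩).

The landed criteria of the `C ≥ 2` regime — the two-level inflow gate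
(`RadialInflowCoreReynolds.exists_coreWidth_twoLevelReynolds`) and its core-strain / core-gradient readings
(`RadialInflowCoreStrain.exists_coreWidth_strainRate`, `…gradientRate`) — ask their hypotheses on the UNIT tube and
from the initial time.  Here both restrictions are removed by Leray's similarity `u ↦ c u(c²·, c·)` (tree:
`isLerayHopfOn_nsRescale`, `IsAxisymmetric.nsRescale_slice`, and the route-independent tools
`RadialInflowSimilarity.nsRescale_classical_Ico` / `nsRescale_hasSmoothExtensionPast` / `nsRescaleData_hasRapidSpatialDecay`
/ `radialVelocity_nsRescale`) and the sub-slab velocity bound: on `[0, T₁]` the solution is bounded by `B`, so on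
the thin tube `r ≤ ν/(B+1)` its inflow Reynolds number is `< 1` there, whatever happens near the axis; the similarity
with `c = ` tube radius maps the thin tube onto the unit tube and leaves every scale-invariant clause (Reynolds gate,
parabolic core `r < ξ₀√(ν(T−t))`, Type-I strain rate `κ₀/(T−t)`) unchanged.

* `exists_coreWidth_twoLevel_tube_nearTop` — for every `Λ₀ > 0` a core width `ξ₀ > 0` with: standing class (incl.
  the sub-slab bound) + on SOME tube `0 < r ≤ δ` and from SOME time `T₁ < T` on, Reynolds number `≤ 1` in the
  parabolic core and `≤ Λ₀` outside ⇒ `HasSmoothExtensionPast`;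
* `exists_coreStrain_tube_nearTop` / `exists_coreGradient_tube_nearTop` — the same with the core clause replaced by
  the one-sided strain bound `u_r ≥ −κ₀ r/(T−t)` / the gradient bound `‖∇u‖ ≤ κ₀/(T−t)` (`κ₀ = 1/ξ₀²`);
* `oneSidedRadialCriterion_of_coreStrain_nearTop` — on the EXACT hypothesis list of the stub (gate `r u_r ≥ −Cν` on
  `{cylRadius < δ} × [0,T)`, ANY `C`): constants `ξ₀, κ₀ > 0` depending ONLY on `C` such that the core strain bound
  on `[T₁, T)` for some `T₁ < T` implies extension;
* `recurrent_coreCompression_of_not_hasSmoothExtensionPast` — blow-up reading: under the stub's gate a non-extending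
  solution shows, for EVERY `T₁ < T`, a time `t ∈ [T₁,T)` and a core point `0 < r < min δ (ξ₀√(ν(T−t)))` with
  `u_r < −κ₀ r/(T−t)` and `‖∇u(t,x)‖ > κ₀/(T−t)`: Type-I-rate one-sided radial compression inside the parabolic core
  RECURS up to the blow-up time (`limsup_{t↑T} (T−t) sup_core (−u_r/r) ≥ κ₀(C) > 0`).

Criteria and their contrapositive; nothing here proves `stub_oneSidedRadialCriterion`, `AxisymSwirlRegular` or
NavierStokesRegularity. [new]
-/

noncomputable section

set_option linter.dupNamespace false

open Set Filter Topology Real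
open Literature.Analysis.FluidPDE
open scoped ContDiff

namespace Summit.NavierStokesRegularity.NavierStokesRegularity.Theorems.RadialInflowCoreStrain

open Summit.NavierStokesRegularity.NavierStokesRegularity.Theorems
open Summit.NavierStokesRegularity.NavierStokesRegularity.Theorems.RadialInflowCoreReynolds
open Summit.NavierStokesRegularity.NavierStokesRegularity.Theorems.ScenarioCensus.LogGate
open Summit.NavierStokesRegularity.NavierStokesRegularity.Theorems.RadialInflowSimilarity

/-! ## §1 The two-level gate on a thin tube, near the blow-up time -/

/-- **Two-level inflow criterion on a thin tube near the blow-up time.** For every `Λ₀ > 0` there is a core width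
`ξ₀ > 0` such that, for all `ν, T > 0` and every classical solution on `[0,T)` at viscosity `ν`, Leray–Hopf from a
rapidly decaying datum, bounded on closed sub-slabs, with axisymmetric slices: if for SOME tube radius `δ > 0` and SOME
time `T₁ < T` the radial velocity obeys, on `{0 < r ≤ δ} × [max T₁ 0, T)`, `u_r ≥ −ν/r` where `r < ξ₀√(ν(T−t))`
(Reynolds number `≤ 1` in the parabolic core) and `u_r ≥ −νΛ₀/r` where `r ≥ ξ₀√(ν(T−t))`, then the solution extends
smoothly past `T`.  Proof: with `B` the velocity bound on `[0, max T₁ 0]` and `δ' = min δ (ν/(max B 0 + 1))`, on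
`{0 < r ≤ δ'}` the Reynolds number is `< 1` up to time `max T₁ 0` (`u_r ≥ −‖u‖`), so both clauses hold there from
`t = 0`; Leray's similarity with `c = δ'` maps them onto the unit-tube hypotheses of `exists_coreWidth_twoLevelReynolds`
(`d₀ = 1`, gate `max Λ₀ 1`) for `c u(c²·, c·)` on `[0, T/c²)`, whose extension scales back. [new] -/
theorem exists_coreWidth_twoLevel_tube_nearTop {Λ₀ : ℝ} (hΛ : 0 < Λ₀) :
    ∃ ξ₀ : ℝ, 0 < ξ₀ ∧ ∀ (ν T : ℝ), 0 < ν → 0 < T →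
      ∀ (u : ℝ → EuclideanSpace ℝ (Fin 3) → EuclideanSpace ℝ (Fin 3)) (p : ℝ → EuclideanSpace ℝ (Fin 3) → ℝ),
      IsClassicalNSSolutionOn (Ico 0 T) ν 0 u p → IsLerayHopfOn T ν 0 (u 0) u → HasRapidSpatialDecay (u 0) →
      (∀ T' < T, ∃ M : ℝ, ∀ t ∈ Icc 0 T', ∀ x, ‖u t x‖ ≤ M) → (∀ t ∈ Ico 0 T, IsAxisymmetric (u t)) →
      ∀ (δ T₁ : ℝ), 0 < δ → T₁ < T →
      (∀ t ∈ Ico 0 T, T₁ ≤ t → ∀ x : EuclideanSpace ℝ (Fin 3), 0 < cylRadius x → cylRadius x ≤ δ →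
        ξ₀ * √(ν * (T - t)) ≤ cylRadius x → -(ν * Λ₀ / cylRadius x) ≤ radialVelocity (u t) x) →
      (∀ t ∈ Ico 0 T, T₁ ≤ t → ∀ x : EuclideanSpace ℝ (Fin 3), 0 < cylRadius x → cylRadius x ≤ δ →
        cylRadius x < ξ₀ * √(ν * (T - t)) → -(ν / cylRadius x) ≤ radialVelocity (u t) x) →
      HasSmoothExtensionPast ν 0 u T := by
  have hΛ1 : 0 < max Λ₀ 1 := lt_of_lt_of_le one_pos (le_max_right _ _)
  obtain ⟨ξ₀, hξ₀, H⟩ := exists_coreWidth_twoLevelReynolds (d₀ := 1) (Λ₀ := max Λ₀ 1) one_pos one_lt_two hΛ1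
  refine ⟨ξ₀, hξ₀, fun ν T hν hT u p hcl hLH hdec hbd hax δ T₁ hδ hT₁ hfar hcore => ?_⟩
  -- the early bound and the thin tube
  set T₀ : ℝ := max T₁ 0 with hT₀_def
  have hT₀T : T₀ < T := max_lt hT₁ hT
  obtain ⟨B, hB⟩ := hbd T₀ hT₀T
  set B' : ℝ := max B 0 + 1 with hB'_def
  have hB'0 : 0 < B' := by rw [hB'_def]; positivity
  have hBB' : B ≤ B' := by rw [hB'_def]; linarith [le_max_left B 0]
  set c : ℝ := min δ (ν / B') with hc_def
  have hc : 0 < c := lt_min hδ (div_pos hν hB'0)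
  have hcδ : c ≤ δ := min_le_left _ _
  have hcB : c * B' ≤ ν := by
    have h1 : c ≤ ν / B' := min_le_right _ _
    rwa [le_div_iff₀ hB'0] at h1
  -- both clauses on the thin tube `{0 < r ≤ c}` from `t = 0`
  have hearly : ∀ t ∈ Ico 0 T, t < T₀ → ∀ x : EuclideanSpace ℝ (Fin 3), 0 < cylRadius x → cylRadius x ≤ c →
      -(ν / cylRadius x) ≤ radialVelocity (u t) x := by
    intro t ht htT₀ x hx hxc
    have hu : ‖u t x‖ ≤ B := hB t ⟨ht.1, htT₀.le⟩ x
    have h1 := neg_norm_le_radialVelocity (u t) hx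
    have h2 : ‖u t x‖ ≤ ν / cylRadius x := by
      rw [le_div_iff₀ hx]
      calc ‖u t x‖ * cylRadius x ≤ B' * c := by
            refine mul_le_mul (hu.trans hBB') hxc (cylRadius_nonneg x) hB'0.le
        _ ≤ ν := by linarith [mul_comm c B']
    linarith
  have hcore' : ∀ t ∈ Ico 0 T, ∀ x : EuclideanSpace ℝ (Fin 3), 0 < cylRadius x → cylRadius x ≤ c →
      cylRadius x < ξ₀ * √(ν * (T - t)) → -(ν / cylRadius x) ≤ radialVelocity (u t) x := by
    intro t ht x hx hxc hxcore
    by_cases htT₀ : t < T₀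
    · exact hearly t ht htT₀ x hx hxc
    · push Not at htT₀
      exact hcore t ht ((le_max_left _ _).trans htT₀) x hx (hxc.trans hcδ) hxcore
  have hfar' : ∀ t ∈ Ico 0 T, ∀ x : EuclideanSpace ℝ (Fin 3), 0 < cylRadius x → cylRadius x ≤ c →
      ξ₀ * √(ν * (T - t)) ≤ cylRadius x → -(ν * max Λ₀ 1 / cylRadius x) ≤ radialVelocity (u t) x := by
    intro t ht x hx hxc hxfar
    have hmono : -(ν * max Λ₀ 1 / cylRadius x) ≤ -(ν / cylRadius x) := by
      rw [neg_le_neg_iff]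
      refine div_le_div_of_nonneg_right ?_ hx.le
      nlinarith [le_max_right Λ₀ 1]
    by_cases htT₀ : t < T₀
    · exact hmono.trans (hearly t ht htT₀ x hx hxc)
    · push Not at htT₀
      have h1 := hfar t ht ((le_max_left _ _).trans htT₀) x hx (hxc.trans hcδ) hxfar
      have hmono' : -(ν * max Λ₀ 1 / cylRadius x) ≤ -(ν * Λ₀ / cylRadius x) := by
        rw [neg_le_neg_iff]
        refine div_le_div_of_nonneg_right ?_ hx.le
        exact mul_le_mul_of_nonneg_left (le_max_left _ _) hν.le
      exact hmono'.trans h1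
  -- Leray's similarity with `c`: the thin tube becomes the unit tube
  have hc2 : 0 < c ^ 2 := pow_pos hc 2
  have hTc : 0 < T / c ^ 2 := div_pos hT hc2
  have hmem : ∀ s ∈ Ico 0 (T / c ^ 2), c ^ 2 * s ∈ Ico 0 T := fun s hs =>
    ⟨mul_nonneg hc2.le hs.1, (lt_div_iff₀' hc2).1 hs.2⟩
  obtain ⟨hclw, hLHw, hdecw, haxw⟩ := standingClass_nsRescale hT hcl hLH hdec hax hc
  -- dictionary between `(s, y)` and `(t, x) = (c² s, c y)`
  have hrad : ∀ y : EuclideanSpace ℝ (Fin 3), cylRadius (c • y) = c * cylRadius y := fun y => by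
    rw [cylRadius_smul, abs_of_pos hc]
  have hsqrt : ∀ s : ℝ, s < T / c ^ 2 → c * √(ν * (T / c ^ 2 - s)) = √(ν * (T - c ^ 2 * s)) := by
    intro s hs
    have e : ν * (T - c ^ 2 * s) = c ^ 2 * (ν * (T / c ^ 2 - s)) := by field_simp
    rw [e, Real.sqrt_mul (sq_nonneg c), Real.sqrt_sq hc.le]
  have hextw : HasSmoothExtensionPast ν 0 (nsRescale c u) (T / c ^ 2) := by
    refine H ν (T / c ^ 2) hν hTc (nsRescale c u) (nsRescalePressure c p) hclw hLHw hdecw haxw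
      (fun s hs y hy hy1 hycore => ?_) (fun s hs y hy hy1 hyfar => ?_)
    · -- core clause
      have hx : 0 < cylRadius (c • y) := by rw [hrad]; exact mul_pos hc hy
      have hxc : cylRadius (c • y) ≤ c := by rw [hrad]; nlinarith
      have hxcore : cylRadius (c • y) < ξ₀ * √(ν * (T - c ^ 2 * s)) := by
        rw [hrad, ← hsqrt s hs.2]
        nlinarith [mul_lt_mul_of_pos_left hycore hc]
      have h1 := hcore' (c ^ 2 * s) (hmem s hs) (c • y) hx hxc hxcore
      rw [radialVelocity_nsRescale hc]
      have e : ν * 1 / cylRadius y = c * (ν / cylRadius (c • y)) := by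
        rw [hrad]; field_simp
      rw [e]
      nlinarith
    · -- far clause
      have hx : 0 < cylRadius (c • y) := by rw [hrad]; exact mul_pos hc hy
      have hxc : cylRadius (c • y) ≤ c := by rw [hrad]; nlinarith
      have hxfar : ξ₀ * √(ν * (T - c ^ 2 * s)) ≤ cylRadius (c • y) := by
        rw [hrad, ← hsqrt s hs.2]
        nlinarith [mul_le_mul_of_nonneg_left hyfar hc.le]
      have h1 := hfar' (c ^ 2 * s) (hmem s hs) (c • y) hx hxc hxfar
      rw [radialVelocity_nsRescale hc]
      have e : ν * max Λ₀ 1 / cylRadius y = c * (ν * max Λ₀ 1 / cylRadius (c • y)) := by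
        rw [hrad]; field_simp
      rw [e]
      nlinarith
  -- scale back with `c⁻¹`
  exact hasSmoothExtensionPast_of_nsRescale hc hextw

/-! ## §2 Core strain / core gradient, thin tube, near the blow-up time -/

/-- **Core-strain criterion on a thin tube near the blow-up time.** For every `Λ₀ > 0` there are `ξ₀, κ₀ > 0`
(`κ₀ = 1/ξ₀²`) such that in the standing class (with the sub-slab bound): a Reynolds gate `u_r ≥ −νΛ₀/r` on
`{0 < r ≤ δ} × [T₁, T)` outside the parabolic core together with the one-sided strain bound `u_r ≥ −κ₀ r/(T−t)` on
the core `{0 < r ≤ δ, r < ξ₀√(ν(T−t))} × [T₁,T)`, for SOME `δ > 0`, `T₁ < T`, implies `HasSmoothExtensionPast`.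
(In the core `κ₀ r/(T−t) ≤ ν/r`.) [new] -/
theorem exists_coreStrain_tube_nearTop {Λ₀ : ℝ} (hΛ : 0 < Λ₀) :
    ∃ ξ₀ κ₀ : ℝ, 0 < ξ₀ ∧ 0 < κ₀ ∧ ∀ (ν T : ℝ), 0 < ν → 0 < T →
      ∀ (u : ℝ → EuclideanSpace ℝ (Fin 3) → EuclideanSpace ℝ (Fin 3)) (p : ℝ → EuclideanSpace ℝ (Fin 3) → ℝ),
      IsClassicalNSSolutionOn (Ico 0 T) ν 0 u p → IsLerayHopfOn T ν 0 (u 0) u → HasRapidSpatialDecay (u 0) →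
      (∀ T' < T, ∃ M : ℝ, ∀ t ∈ Icc 0 T', ∀ x, ‖u t x‖ ≤ M) → (∀ t ∈ Ico 0 T, IsAxisymmetric (u t)) →
      ∀ (δ T₁ : ℝ), 0 < δ → T₁ < T →
      (∀ t ∈ Ico 0 T, T₁ ≤ t → ∀ x : EuclideanSpace ℝ (Fin 3), 0 < cylRadius x → cylRadius x ≤ δ →
        ξ₀ * √(ν * (T - t)) ≤ cylRadius x → -(ν * Λ₀ / cylRadius x) ≤ radialVelocity (u t) x) →
      (∀ t ∈ Ico 0 T, T₁ ≤ t → ∀ x : EuclideanSpace ℝ (Fin 3), 0 < cylRadius x → cylRadius x ≤ δ →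
        cylRadius x < ξ₀ * √(ν * (T - t)) → -(κ₀ * cylRadius x / (T - t)) ≤ radialVelocity (u t) x) →
      HasSmoothExtensionPast ν 0 u T := by
  obtain ⟨ξ₀, hξ₀, H⟩ := exists_coreWidth_twoLevel_tube_nearTop hΛ
  refine ⟨ξ₀, 1 / ξ₀ ^ 2, hξ₀, by positivity, ?_⟩
  intro ν T hν hT u p hcl hLH hdec hbd hax δ T₁ hδ hT₁ hfar hstrain
  refine H ν T hν hT u p hcl hLH hdec hbd hax δ T₁ hδ hT₁ hfar fun t ht htT₁ x hx hxδ hcore => ?_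
  have hs : 0 < T - t := by linarith [ht.2]
  have hνs : 0 < ν * (T - t) := mul_pos hν hs
  have h1 := hstrain t ht htT₁ x hx hxδ hcore
  have hsq : cylRadius x ^ 2 < ξ₀ ^ 2 * (ν * (T - t)) := by
    have h2 : cylRadius x ^ 2 < (ξ₀ * √(ν * (T - t))) ^ 2 :=
      pow_lt_pow_left₀ hcore (cylRadius_nonneg x) two_ne_zero
    rwa [mul_pow, Real.sq_sqrt hνs.le] at h2
  have h3 : 1 / ξ₀ ^ 2 * cylRadius x / (T - t) ≤ ν / cylRadius x := by
    rw [div_le_div_iff₀ hs hx]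
    have h4 : 1 / ξ₀ ^ 2 * cylRadius x * cylRadius x = cylRadius x ^ 2 / ξ₀ ^ 2 := by
      field_simp
    rw [h4, div_le_iff₀ (by positivity : (0 : ℝ) < ξ₀ ^ 2)]
    nlinarith
  linarith

/-- **Core-gradient criterion on a thin tube near the blow-up time**: as `exists_coreStrain_tube_nearTop` with the core
clause `‖fderiv ℝ (u t) x‖ ≤ κ₀/(T−t)` (`|u_r| ≤ r‖∇u‖` for axisymmetric slices). [new] -/
theorem exists_coreGradient_tube_nearTop {Λ₀ : ℝ} (hΛ : 0 < Λ₀) :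
    ∃ ξ₀ κ₀ : ℝ, 0 < ξ₀ ∧ 0 < κ₀ ∧ ∀ (ν T : ℝ), 0 < ν → 0 < T →
      ∀ (u : ℝ → EuclideanSpace ℝ (Fin 3) → EuclideanSpace ℝ (Fin 3)) (p : ℝ → EuclideanSpace ℝ (Fin 3) → ℝ),
      IsClassicalNSSolutionOn (Ico 0 T) ν 0 u p → IsLerayHopfOn T ν 0 (u 0) u → HasRapidSpatialDecay (u 0) →
      (∀ T' < T, ∃ M : ℝ, ∀ t ∈ Icc 0 T', ∀ x, ‖u t x‖ ≤ M) → (∀ t ∈ Ico 0 T, IsAxisymmetric (u t)) →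
      ∀ (δ T₁ : ℝ), 0 < δ → T₁ < T →
      (∀ t ∈ Ico 0 T, T₁ ≤ t → ∀ x : EuclideanSpace ℝ (Fin 3), 0 < cylRadius x → cylRadius x ≤ δ →
        ξ₀ * √(ν * (T - t)) ≤ cylRadius x → -(ν * Λ₀ / cylRadius x) ≤ radialVelocity (u t) x) →
      (∀ t ∈ Ico 0 T, T₁ ≤ t → ∀ x : EuclideanSpace ℝ (Fin 3), 0 < cylRadius x → cylRadius x ≤ δ →
        cylRadius x < ξ₀ * √(ν * (T - t)) → ‖fderiv ℝ (u t) x‖ ≤ κ₀ / (T - t)) →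
      HasSmoothExtensionPast ν 0 u T := by
  obtain ⟨ξ₀, κ₀, hξ₀, hκ₀, H⟩ := exists_coreStrain_tube_nearTop hΛ
  refine ⟨ξ₀, κ₀, hξ₀, hκ₀, ?_⟩
  intro ν T hν hT u p hcl hLH hdec hbd hax δ T₁ hδ hT₁ hfar hgrad
  refine H ν T hν hT u p hcl hLH hdec hbd hax δ T₁ hδ hT₁ hfar fun t ht htT₁ x hx hxδ hcore => ?_
  have hd : DifferentiableAt ℝ (u t) x :=
    ((hcl.contDiff_velocity ht).differentiable (by simp)).differentiableAt
  have h1 : |radialVelocity (u t) x| ≤ cylRadius x * ‖fderiv ℝ (u t) x‖ :=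
    abs_radialVelocity_le_mul_norm_fderiv (hax t ht) hd
  have h2 : cylRadius x * ‖fderiv ℝ (u t) x‖ ≤ cylRadius x * (κ₀ / (T - t)) :=
    mul_le_mul_of_nonneg_left (hgrad t ht htT₁ x hx hxδ hcore) (cylRadius_nonneg x)
  have h3 : cylRadius x * (κ₀ / (T - t)) = κ₀ * cylRadius x / (T - t) := by ring
  have h4 := (abs_le.1 (h1.trans (h2.trans_eq h3))).1
  linarith

/-! ## §3 On the stub's hypothesis list: constants depending only on the gate constant `C` -/

/-- **The stub ⟨19059⟩ reduced to core radial compression near the blow-up time, with constants depending only on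
the gate constant.** For every `C` there are `ξ₀, κ₀ > 0` such that, on the exact hypothesis list of
`stub_oneSidedRadialCriterion` with gate `x₀u₀ + x₁u₁ = r u_r ≥ −Cν` on `{cylRadius < δ} × [0,T)`: if for SOME `T₁ < T`
the one-sided radial strain bound `u_r ≥ −κ₀ r/(T−t)` holds at the core points `0 < r < δ`, `r < ξ₀√(ν(T−t))` for
`t ∈ [T₁,T)`, then `HasSmoothExtensionPast ν 0 u T`.  (Gate constant `Λ₀ = max C 1` on the tube `r ≤ δ/2`;
`exists_coreStrain_tube_nearTop`.) [new] -/
theorem oneSidedRadialCriterion_of_coreStrain_nearTop (C : ℝ) :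
    ∃ ξ₀ κ₀ : ℝ, 0 < ξ₀ ∧ 0 < κ₀ ∧ ∀ (ν T : ℝ), 0 < ν → 0 < T →
      ∀ (u : ℝ → EuclideanSpace ℝ (Fin 3) → EuclideanSpace ℝ (Fin 3)) (p : ℝ → EuclideanSpace ℝ (Fin 3) → ℝ),
      IsClassicalNSSolutionOn (Ico 0 T) ν 0 u p → IsLerayHopfOn T ν 0 (u 0) u →
      (∀ T' < T, ∃ M : ℝ, ∀ t ∈ Icc 0 T', ∀ x, ‖u t x‖ ≤ M) → (∀ t ∈ Ico 0 T, IsAxisymmetric (u t)) →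
      HasRapidSpatialDecay (u 0) →
      ∀ (δ : ℝ), 0 < δ →
      (∀ t ∈ Ico 0 T, ∀ x : EuclideanSpace ℝ (Fin 3), cylRadius x < δ → -(C * ν) ≤ x 0 * u t x 0 + x 1 * u t x 1) →
      ∀ (T₁ : ℝ), T₁ < T →
      (∀ t ∈ Ico 0 T, T₁ ≤ t → ∀ x : EuclideanSpace ℝ (Fin 3), 0 < cylRadius x → cylRadius x < δ →
        cylRadius x < ξ₀ * √(ν * (T - t)) → -(κ₀ * cylRadius x / (T - t)) ≤ radialVelocity (u t) x) →
      HasSmoothExtensionPast ν 0 u T := by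
  have hΛ : 0 < max C 1 := lt_of_lt_of_le one_pos (le_max_right _ _)
  obtain ⟨ξ₀, κ₀, hξ₀, hκ₀, H⟩ := exists_coreStrain_tube_nearTop hΛ
  refine ⟨ξ₀, κ₀, hξ₀, hκ₀, ?_⟩
  intro ν T hν hT u p hcl hLH hbd hax hdec δ hδ hgate T₁ hT₁ hstrain
  refine H ν T hν hT u p hcl hLH hdec hbd hax (δ / 2) T₁ (half_pos hδ) hT₁
    (fun t ht _ x hx hxδ _ => ?_) (fun t ht htT₁ x hx hxδ hcore => hstrain t ht htT₁ x hx (by linarith) hcore)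
  -- the stub's gate gives the Reynolds gate `max C 1` on `r ≤ δ/2 < δ`
  have h1 := hgate t ht x (by linarith)
  rw [radialVelocity_eq_div']
  have h2 : -(ν * max C 1 / cylRadius x) ≤ -(C * ν) / cylRadius x := by
    rw [neg_div]
    refine neg_le_neg (div_le_div_of_nonneg_right ?_ hx.le)
    nlinarith [le_max_left C 1]
  exact h2.trans (div_le_div_of_nonneg_right h1 hx.le)

/-! ## §4 Blow-up reading: recurrent Type-I-rate core compression -/

/-- **Blow-up under the gate forces RECURRENT Type-I-rate radial compression inside the parabolic core.** In the
standing class of the stub, under its gate `r u_r ≥ −Cν` on `{cylRadius < δ} × [0,T)` (any `C`), let `ξ₀, κ₀ > 0` be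
the constants of `oneSidedRadialCriterion_of_coreStrain_nearTop C` (they depend only on `C`).  If the solution does
NOT extend smoothly past `T`, then for EVERY `T₁ < T` there are `t ∈ [T₁, T) ∩ [0,T)` and a core point `x`
(`0 < r < δ`, `r < ξ₀√(ν(T−t))`) with `u_r(t,x) < −κ₀ r/(T−t)` and `‖∇u(t,x)‖ > κ₀/(T−t)`: one-sided radial
compression beyond the Type-I rate recurs in the parabolic core up to the blow-up time,
`limsup_{t↑T} (T−t)·sup_core (−u_r/r) ≥ κ₀(C)`. [new] -/
theorem recurrent_coreCompression_of_not_hasSmoothExtensionPast (C : ℝ) :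
    ∃ ξ₀ κ₀ : ℝ, 0 < ξ₀ ∧ 0 < κ₀ ∧ ∀ (ν T : ℝ), 0 < ν → 0 < T →
      ∀ (u : ℝ → EuclideanSpace ℝ (Fin 3) → EuclideanSpace ℝ (Fin 3)) (p : ℝ → EuclideanSpace ℝ (Fin 3) → ℝ),
      IsClassicalNSSolutionOn (Ico 0 T) ν 0 u p → IsLerayHopfOn T ν 0 (u 0) u →
      (∀ T' < T, ∃ M : ℝ, ∀ t ∈ Icc 0 T', ∀ x, ‖u t x‖ ≤ M) → (∀ t ∈ Ico 0 T, IsAxisymmetric (u t)) →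
      HasRapidSpatialDecay (u 0) →
      ∀ (δ : ℝ), 0 < δ →
      (∀ t ∈ Ico 0 T, ∀ x : EuclideanSpace ℝ (Fin 3), cylRadius x < δ → -(C * ν) ≤ x 0 * u t x 0 + x 1 * u t x 1) →
      ¬ HasSmoothExtensionPast ν 0 u T →
      ∀ (T₁ : ℝ), T₁ < T → ∃ t ∈ Ico 0 T, T₁ ≤ t ∧ ∃ x : EuclideanSpace ℝ (Fin 3),
        0 < cylRadius x ∧ cylRadius x < δ ∧ cylRadius x < ξ₀ * √(ν * (T - t)) ∧
        radialVelocity (u t) x < -(κ₀ * cylRadius x / (T - t)) ∧ κ₀ / (T - t) < ‖fderiv ℝ (u t) x‖ := by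
  obtain ⟨ξ₀, κ₀, hξ₀, hκ₀, H⟩ := oneSidedRadialCriterion_of_coreStrain_nearTop C
  refine ⟨ξ₀, κ₀, hξ₀, hκ₀, ?_⟩
  intro ν T hν hT u p hcl hLH hbd hax hdec δ hδ hgate hno T₁ hT₁
  by_contra hcon
  push Not at hcon
  refine hno (H ν T hν hT u p hcl hLH hbd hax hdec δ hδ hgate T₁ hT₁ fun t ht htT₁ x hx hxδ hcore => ?_)
  by_contra hlt
  push Not at hlt
  -- then the gradient is also beyond the Type-I rate at `(t, x)`, contradicting `hcon`
  have hd : DifferentiableAt ℝ (u t) x :=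
    ((hcl.contDiff_velocity ht).differentiable (by simp)).differentiableAt
  have h1 : |radialVelocity (u t) x| ≤ cylRadius x * ‖fderiv ℝ (u t) x‖ :=
    abs_radialVelocity_le_mul_norm_fderiv (hax t ht) hd
  have h2 : κ₀ * cylRadius x / (T - t) < cylRadius x * ‖fderiv ℝ (u t) x‖ := by
    have := (abs_le.1 h1).1
    linarith
  have h3 : κ₀ / (T - t) < ‖fderiv ℝ (u t) x‖ := by
    by_contra h4
    push Not at h4
    have h5 : cylRadius x * ‖fderiv ℝ (u t) x‖ ≤ cylRadius x * (κ₀ / (T - t)) :=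
      mul_le_mul_of_nonneg_left h4 (cylRadius_nonneg x)
    have h6 : cylRadius x * (κ₀ / (T - t)) = κ₀ * cylRadius x / (T - t) := by ring
    linarith
  exact absurd h3 (not_lt.2 (hcon t ht htT₁ x hx hxδ hcore hlt))

end Summit.NavierStokesRegularity.NavierStokesRegularity.Theorems.RadialInflowCoreStrain

end
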